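import Summits.Ventures.HodgeRepro2.T6N41PlaceUniv

/-!
# T6N41Placed — the placement data of (P7) BUNDLED with the N4.1 datum (wave 1, p437353; owner t6-p4)

The M2-FINAL binds, per side, the five DATA `Pl In Sp LQ Kd` (ledger rows 113–117 / 156–160) over `M.sA.d41` /
`M.sB.d41`, the seven displays, the dichotomy `hdich` and the residual `hκ'` (rows 125–126 / 168–169).  The
universal chain `T6.N41PlaceUniv` does NOT transfer these rows to a host datum (it is universal over
`S`-everywhere datums only — its `hS` is unsatisfiable over an infinite place type, and NO term
`Φ : ∀ D, PlacementDatum D` exists at all: `N41PlaceUnivProbe.not_forall_mem_S` / `no_uniform_placement`).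
The ONE shape in which the five DATA rows can leave a successor statement is RE-TYPING: a successor datum field
`d41p : PlacedLDatum ι` carrying the datum together with its placement data (the C12 (ii) pattern of the seat-map
draft for `NSide.d43`).  This moves the COUNT (DATA −5 per side on a successor statement), not the content — the
host still supplies the same local objects, inside the bundle; the displays, `hdich` and `hκ'` stay binders
(`hdich` = the bundle's `Dich`, `hκ'` = its `Kappa'`, NOT bundled: a residual hidden in a datum field would move
the modulo-datum boundary, README §10.4 / ledger l. 383).  The §10.5(ii)(d) witness side is covered: every
`S`-everywhere datum bundles through `univ` with `Dich` / `Kappa'` theorems.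

§8(d): uses an L-value-free non-vanishing device: NO.
-/

namespace Summit.Ventures.HodgeRepro2.T6

/-- The N4.1 datum of one cuspidal `π` together with the local-representation data of its placement (P7):
the DATA binders `Pl In Sp LQ Kd` of the M2-FINAL, bundled with `D`. -/
structure PlacedLDatum (ι : Type) where
  /-- the N4.1 datum (`DoublingLDatum`) -/
  D : DoublingLDatum ι
  /-- the placement datum over `D` (the primes of `E`, Satake parameters, `η₁′(𝔓)`, `η₂′(𝔓)`) -/
  Pl : PlacementDatum D
  /-- the inert-place datum -/
  In : InertDatum Pl
  /-- the split-place datum -/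
  Sp : SplitDatum In
  /-- the Langlands-quotient carrier at the split places -/
  LQ : SplitLQ Sp
  /-- the convention-character datum (κ_v, κ′, Hilbert symbols) -/
  Kd : KappaDatum Sp

namespace PlacedLDatum

variable {ι : Type} (R : PlacedLDatum ι)

/-- The dichotomy `hdich` of `N41_placement_kappa` on the bundle: every prime above a place outside `S` is inert
or lies over a split place. -/
def Dich : Prop :=
  ∀ 𝔓, R.Pl.b 𝔓 ∉ R.D.S → R.In.inert 𝔓 ∨ R.Sp.splitPlace (R.Pl.b 𝔓)

/-- The residual `hκ'` of `N41_placement_kappa` on the bundle [residual: AD — TIER5 §N4.1.10 Lemma A′-4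
(b4)–(b6), the local convention identity `κ_v(ϖ_v) = κ′(ϖ_v)⁻¹`]. -/
def Kappa' : Prop :=
  ∀ v, R.Sp.splitPlace v → v ∉ R.D.S → R.Kd.κv v = (R.Kd.κ' v)⁻¹

/-- **The placement (P7) on the bundle**: `N41Place.N41_placement_kappa` with the five data read off `R`; the seven
displays are consumed by name, `hdich` / `hκ'` stay explicit. -/
theorem placement_kappa (hLR7 : Hyp.LapidRallis2005_Sec7_Unramified R.D R.Pl) (hB : Hyp.Bump1997_5_22 R.Pl)
    (hHa : Hyp.HarrisII2007_Prop2_2_5_b R.In) (hRo : Hyp.Rogawski1990_Sec11_4_BC R.In)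
    (hM : Hyp.Minguez2008_Thm1_2_LQ R.LQ) (hB451 : Hyp.Bump1997_Thm4_5_1 R.LQ)
    (hRao : Hyp.Rao1993_CorA5_1 R.Kd) (hdich : R.Dich) (hκ' : R.Kappa') :
    ∀ v ∉ R.D.S, ∀ s : ℂ, R.D.Lv v s = R.D.g₁ v s * R.D.g₂ v s :=
  N41Place.N41_placement_kappa R.D R.Pl R.In R.Sp R.LQ R.Kd hLR7 hB hHa hRo hM hB451 hRao hdich hκ'

/-- Every `S`-everywhere datum bundles through the universal chain (the witness side of a successor statement). -/
@[reducible] noncomputable def univ (D : DoublingLDatum ι) (hS : ∀ v, v ∈ D.S) : PlacedLDatum ι :=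
  ⟨D, N41PlaceUniv.univPl D hS, N41PlaceUniv.univIn D hS, N41PlaceUniv.univSp D hS,
    N41PlaceUniv.univLQ D hS, N41PlaceUniv.univKd D hS⟩

/-- The bundle's datum is `D` (by `rfl`). -/
theorem univ_D (D : DoublingLDatum ι) (hS : ∀ v, v ∈ D.S) : (univ D hS).D = D := rfl

/-- The dichotomy holds on the universal bundle. -/
theorem univ_dich (D : DoublingLDatum ι) (hS : ∀ v, v ∈ D.S) : (univ D hS).Dich :=
  N41PlaceUniv.univ_dich D hS

/-- The residual `hκ'` holds on the universal bundle. -/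
theorem univ_kappa' (D : DoublingLDatum ι) (hS : ∀ v, v ∈ D.S) : (univ D hS).Kappa' :=
  N41PlaceUniv.univ_kappa' D hS

/-- The placement composed on the universal bundle (vacuous conclusion on such a `D`, as in `univ_placement_kappa`). -/
theorem univ_placement_kappa (D : DoublingLDatum ι) (hS : ∀ v, v ∈ D.S) :
    ∀ v ∉ D.S, ∀ s : ℂ, D.Lv v s = D.g₁ v s * D.g₂ v s :=
  (univ D hS).placement_kappa (N41PlaceUniv.univ_LR7 D hS) (N41PlaceUniv.univ_Bump D hS)
    (N41PlaceUniv.univ_Harris D hS) (N41PlaceUniv.univ_Rogawski D hS) (N41PlaceUniv.univ_Minguez D hS)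
    (N41PlaceUniv.univ_Bump451 D hS) (N41PlaceUniv.univ_Rao D hS) (univ_dich D hS) (univ_kappa' D hS)

end PlacedLDatum

end Summit.Ventures.HodgeRepro2.T6

#print axioms Summit.Ventures.HodgeRepro2.T6.PlacedLDatum.placement_kappa
#print axioms Summit.Ventures.HodgeRepro2.T6.PlacedLDatum.univ_placement_kappa
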